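import Summits.QuantumFields.YangMills.Theorems.PoincareLipschitzRegaugedStep
import Literature.MathematicalPhysics.QuantumLattice.SU2Haar
import Summits.QuantumFields.YangMills.Theorems.UnitScaleTiltProp7LogRemainderMass
import HarnessLib

/-!
# Crux stmt-QuantumFields-19936 `UnitScaleTilt.HistoryTailL`, K2 at depth (route crux `PoincareLipschitz.BlockLipschitzL`, stmt-QuantumFields-23533),
# K2 supplier plan of record (card v1.27 (c)), file F5b-1 — THE SKEW PROJECTION OF THE LEVEL RATIO: `Z = (Y − Y*)/2` is `𝔰𝔲(2)`-valued for
# `Y = W·V* − 1`, `V, W ∈ SU(2)`, within `‖Y‖²/2` of `Y`, and its covariant comb mean is within `m²/2` of that of `Y`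

Cell `ym3-torus` (YM ladder rung R3 = continuum SU(2) Yang–Mills on the three-torus — a RUNG, NOT the Clay problem: not d = 4, not infinite
volume, not a mass gap); width seat `ym-ust-19936-w2` g10, pen F5 of the K2 supplier plan (LEAD `ym-ust-19936-w1` g7, 2026-08-29T00:35:51Z).
Helper `--supports stmt-QuantumFields-19936`; THEOREMS ONLY (0 `def`, 0 `sorry`).  Nothing here proves `hStab`, a stub, `BlockLipschitzL`,
`HistoryTailL` or a summit statement.

WHY.  The re-gauged step ✓`PoincareLipschitzRegaugedStep.norm_pertVar_avgFun_regauged_le_nbhdMass` (F5a) absorbs an ABSTRACT site function `ξ`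
within `δ` of the covariant comb mean `CM_Y` of the ratio `Y = pertVar V W`; for `exp(−ξ)` to be an honest `SU(2)` gauge transformation
(✓`PoincareLipschitzRegaugeAbsorption.exists_gaugeTransf_coe_eq_exp_neg`) `ξ` must be `𝔰𝔲(2)`-valued, which `CM_Y` is NOT (`Y = X − 1` with `X`
unitary has Hermitian part `−Y·Y*/2 ≠ 0`).  The cure costs nothing at second order: the skew part `Z = (Y − Y*)/2` is skew-Hermitian, TRACELESS on
`SU(2)` (the trace of an `SU(2)` matrix is real: `U₁₁ = conj U₀₀`, ✓`QuantumLattice.su2_apply_11`), `Y − Z = (Y + Y*)/2 = −Y·Y*/2` has norm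
`≤ ‖Y‖²/2`, and the comb mean is linear (✓`covWalkSum_add`/`covWalkSum_smul`), so `‖CM_Z(y) − CM_Y(y)‖ ≤ Σ_{comb}‖Y‖²/2 ≤ (σ/2)·(comb mass) ≤ m²/2`
for `σ` a sup and `m` a mass bound — the `δ` of F5a; and `CM_Z` is `𝔰𝔲(2)`-valued by the reality letters ✓`Prop7TrueLinReality.su_covCombMean`.

WHAT IS PROVED (ns `…Theorems.PoincareLipschitzSkewProjection`).
* §1 (any rank) `add_star_eq_neg_mul_star` (`Y + Y* = −Y·Y*` for `Y = X − 1`, `X·X* = 1`), `star_skewPart`, `norm_sub_skewPart_le` (`‖Y − Z‖ ≤ ‖Y‖²/2`),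
  `norm_skewPart_le` (`‖Z‖ ≤ ‖Y‖`); §2 (`SU(2)`) `star_trace_coe_su2` (the trace is self-conjugate), `trace_skewPart_pertVar_eq_zero`, ★ `su_skewPart_pertVar`
  (`Z_b ∈ 𝔰𝔲(2)` in the tree's spelling `star X = -X ∧ X.trace = 0`).
* §3 (any rank; ✓`Prop7LogRemainderMass.covWalkSum_sub` reused) `mass_le_of_sq` (walk mass of `Y − Z` ≤ `(σ/2)·`mass of `Y` under a sup `σ` on the walk),
  ★ `norm_combMean_skewPart_sub_le` (`‖CM_Z(y) − CM_Y(y)‖ ≤ (σ/2)·m`), ★★ `norm_combMean_skewPart_sub_le_nbhdMass` (at `y ∈ {c₋, c₊}`, standing range: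
  `≤ ((d+2)L·S(c))²/2` with `S(c)` the two-block mass of F5a), ★ `su_combMean_skewPart` (`CM_Z(y) ∈ 𝔰𝔲(2)`, via ✓`su_covCombMean`).
HONEST SCOPE.  Matrix algebra and bookkeeping; nothing of [Balaban1985Averaging] is asserted.

References: T. Bałaban, CMP 98 (1985) 17–51 [Balaban1985Averaging] ((62) p.28, §3 (156)–(163)); CMP 102 (1985) 277–309 [Balaban1985Variational] ((15) p.280).
-/

noncomputable section

open scoped BigOperators Matrix.Norms.L2Operator

namespace Summit.QuantumFields.YangMills.Theorems.PoincareLipschitzSkewProjection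

open Literature.MathematicalPhysics.QuantumFieldTheory.Balaban1983to89
open Finset T4Continuum BlockAveraging AveragingRT ExpMeanLog BlockAveragingEMLLinearised BlockAveragingEMLLinearisedBackground BlockAveragingEMLProp2
open Summit.QuantumFields.YangMills.Theorems.Prop7HolRatioPerStep (coe_star_mul_self coe_mul_star_self norm_coe_eq_one norm_star_coe_eq_one
  norm_covWalkSum_le_mass norm_mean_le')
open Summit.QuantumFields.YangMills.Theorems.Prop7TrueLinDefectBound (mass_comb_tgt_le)
open Summit.QuantumFields.YangMills.Theorems.PoincareLipschitzRegaugedStep (mass_comb_src_le)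
open Summit.QuantumFields.YangMills.Theorems.Prop7TrueLinReality (su_covCombMean)
open Summit.QuantumFields.YangMills.Theorems.Prop7LogRemainderMass (covWalkSum_sub)

/-! ## §1 The skew part of `Y = X − 1`, `X` unitary (any rank) -/

section Skew

variable {n : Type*} [Fintype n] [DecidableEq n]

/-- For `X·X* = 1` and `Y = X − 1`: `Y + Y* = −Y·Y*`. [folklore] -/
theorem add_star_eq_neg_mul_star {X : Matrix n n ℂ} (hX : X * star X = 1) : (X - 1) + star (X - 1) = -((X - 1) * star (X - 1)) := by
  rw [star_sub, star_one]
  have : (X - 1) * (star X - 1) = X * star X - X - star X + 1 := by noncomm_ring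
  rw [this, hX]
  abel

omit [Fintype n] [DecidableEq n] in
/-- The skew part is skew: `star ((Y − Y*)/2) = −(Y − Y*)/2`. [folklore] -/
theorem star_skewPart (Y : Matrix n n ℂ) : star ((2 : ℂ)⁻¹ • (Y - star Y)) = -((2 : ℂ)⁻¹ • (Y - star Y)) := by
  rw [star_smul, star_sub, star_star, ← smul_neg, neg_sub]
  congr 1
  simp

/-- `‖(Y − Y*)/2‖ ≤ ‖Y‖`. [folklore] -/
theorem norm_skewPart_le (Y : Matrix n n ℂ) : ‖(2 : ℂ)⁻¹ • (Y - star Y)‖ ≤ ‖Y‖ := by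
  rw [norm_smul, norm_inv, Complex.norm_ofNat]
  have h : ‖Y - star Y‖ ≤ ‖Y‖ + ‖Y‖ := (norm_sub_le _ _).trans (by rw [norm_star])
  linarith

/-- **The skew projection is second-order close**: for `X·X* = 1`, `Y = X − 1`, `‖Y − (Y − Y*)/2‖ ≤ ‖Y‖²/2` (`Y − Z = (Y + Y*)/2 = −Y·Y*/2`). [folklore] -/
theorem norm_sub_skewPart_le {X : Matrix n n ℂ} (hX : X * star X = 1) :
    ‖(X - 1) - (2 : ℂ)⁻¹ • ((X - 1) - star (X - 1))‖ ≤ ‖X - 1‖ ^ 2 / 2 := by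
  have e : (X - 1) - (2 : ℂ)⁻¹ • ((X - 1) - star (X - 1)) = (2 : ℂ)⁻¹ • ((X - 1) + star (X - 1)) := by
    have h1 : (X - 1) - (2 : ℂ)⁻¹ • ((X - 1) - star (X - 1)) = (1 - (2 : ℂ)⁻¹) • (X - 1) + (2 : ℂ)⁻¹ • star (X - 1) := by
      rw [sub_smul, one_smul, smul_sub]; abel
    rw [h1, show (1 - (2 : ℂ)⁻¹) = (2 : ℂ)⁻¹ by norm_num, ← smul_add]
  rw [e, add_star_eq_neg_mul_star hX, smul_neg, norm_neg, norm_smul, norm_inv, Complex.norm_ofNat]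
  have h := norm_mul_le (X - 1) (star (X - 1))
  rw [norm_star] at h
  nlinarith [norm_nonneg (X - 1)]

end Skew

/-! ## §2 On `SU(2)` the skew part of the level ratio is traceless -/

section SU2

open Literature.MathematicalPhysics.QuantumLattice (su2_apply_11)

/-- The trace of an `SU(2)` matrix is self-conjugate (`U₁₁ = conj U₀₀`). [folklore] -/
theorem star_trace_coe_su2 (U : Matrix.specialUnitaryGroup (Fin 2) ℂ) :
    star ((U : Matrix (Fin 2) (Fin 2) ℂ).trace) = (U : Matrix (Fin 2) (Fin 2) ℂ).trace := by
  rw [Matrix.trace_fin_two, su2_apply_11, Complex.star_def, map_add, Complex.conj_conj, add_comm]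

variable {P : Params} {j : ℕ}

/-- The skew part of `pertVar V W b` is traceless on `SU(2)`. [folklore] -/
theorem trace_skewPart_pertVar_eq_zero (V W : GaugeField P j (Matrix.specialUnitaryGroup (Fin 2) ℂ)) (b : PBond P j) :
    ((2 : ℂ)⁻¹ • (pertVar V W b - star (pertVar V W b))).trace = 0 := by
  rw [Matrix.trace_smul, Matrix.trace_sub, Matrix.star_eq_conjTranspose, Matrix.trace_conjTranspose, smul_eq_zero]
  right
  rw [pertVar, Matrix.trace_sub, Matrix.trace_one, star_sub, star_trace_coe_su2]
  simp

/-- ★ **THE SKEW PROJECTION OF THE LEVEL RATIO IS `𝔰𝔲(2)`-VALUED** (tree spelling `star X = -X ∧ X.trace = 0`). [folklore] -/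
theorem su_skewPart_pertVar (V W : GaugeField P j (Matrix.specialUnitaryGroup (Fin 2) ℂ)) (b : PBond P j) :
    star ((2 : ℂ)⁻¹ • (pertVar V W b - star (pertVar V W b))) = -((2 : ℂ)⁻¹ • (pertVar V W b - star (pertVar V W b))) ∧
      ((2 : ℂ)⁻¹ • (pertVar V W b - star (pertVar V W b))).trace = 0 :=
  ⟨star_skewPart _, trace_skewPart_pertVar_eq_zero V W b⟩

/-- The skew projection of `pertVar V W b` is second-order close to it (any rank). [folklore] -/
theorem norm_pertVar_sub_skewPart_le {n : Type*} [Fintype n] [DecidableEq n] (V W : GaugeField P j (Matrix.specialUnitaryGroup n ℂ)) (b : PBond P j) :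
    ‖pertVar V W b - (2 : ℂ)⁻¹ • (pertVar V W b - star (pertVar V W b))‖ ≤ ‖pertVar V W b‖ ^ 2 / 2 := by
  rw [pertVar_eq]
  refine norm_sub_skewPart_le (X := ((W b : Matrix.specialUnitaryGroup n ℂ) : Matrix n n ℂ) * star ((V b : Matrix.specialUnitaryGroup n ℂ) : Matrix n n ℂ)) ?_
  rw [star_mul, star_star, mul_assoc, ← mul_assoc (star _), coe_star_mul_self, one_mul, coe_mul_star_self]

end SU2

/-! ## §3 The comb mean of the skew projection versus that of the ratio (any rank) -/

section Comb

variable {P : Params} {n : Type*} [Fintype n] [DecidableEq n] [Nonempty n] {j : ℕ}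

omit [Nonempty n] in
/-- Walk mass of a second-order perturbation: if `‖D b‖ ≤ ‖Y b‖²/2` and `‖Y b‖ ≤ σ` along the walk then `Σ‖D‖ ≤ (σ/2)·Σ‖Y‖`. [folklore] -/
theorem mass_le_of_sq {Y D : PBond P j → Matrix n n ℂ} {σ : ℝ} :
    ∀ w : List (LStep P j), (∀ s ∈ w, ‖D s.bond‖ ≤ ‖Y s.bond‖ ^ 2 / 2) → (∀ s ∈ w, ‖Y s.bond‖ ≤ σ) →
      (w.map fun s => ‖D s.bond‖).sum ≤ σ / 2 * (w.map fun s => ‖Y s.bond‖).sum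
  | [], _, _ => by simp
  | s :: w, hD, hσ => by
    rw [List.map_cons, List.sum_cons, List.map_cons, List.sum_cons, mul_add]
    have h1 : ‖D s.bond‖ ≤ σ / 2 * ‖Y s.bond‖ := by
      have := hD s List.mem_cons_self
      have hs := hσ s List.mem_cons_self
      nlinarith [norm_nonneg (Y s.bond)]
    exact add_le_add h1 (mass_le_of_sq w (fun s' hs' => hD s' (List.mem_cons_of_mem _ hs')) (fun s' hs' => hσ s' (List.mem_cons_of_mem _ hs')))

/-- ★ **THE COMB MEAN OF THE SKEW PROJECTION IS WITHIN `(σ/2)·m` OF THE COMB MEAN OF THE RATIO** at a coarse site `y`: comb masses of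
`Y = pertVar V W` at `y` bounded by `m`, `‖Y b‖ ≤ σ` on the comb bonds. [cite: Balaban1985Averaging, (62) p.28] -/
theorem norm_combMean_skewPart_sub_le (V W : GaugeField P j (Matrix.specialUnitaryGroup n ℂ)) (y : Site P (j + 1)) {m σ : ℝ}
    (hmC : ∀ (τ : Equiv.Perm (Fin P.d)) (r : Fin P.d → Fin P.L), ((walk (emb y) (stairWord τ (off r))).map fun s => ‖pertVar V W s.bond‖).sum ≤ m)
    (hσ : ∀ (τ : Equiv.Perm (Fin P.d)) (r : Fin P.d → Fin P.L), ∀ s ∈ walk (emb y) (stairWord τ (off r)), ‖pertVar V W s.bond‖ ≤ σ) (hσ0 : 0 ≤ σ) :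
    ‖((Fintype.card (Idx P) : ℂ))⁻¹ • ∑ i : Idx P,
          covWalkSum V (fun b => (2 : ℂ)⁻¹ • (pertVar V W b - star (pertVar V W b))) (walk (emb y) (stairWord i.2.1 (off i.1)))
        - ((Fintype.card (Idx P) : ℂ))⁻¹ • ∑ i : Idx P, covWalkSum V (pertVar V W) (walk (emb y) (stairWord i.2.1 (off i.1)))‖ ≤ σ / 2 * m := by
  rw [← smul_sub, ← Finset.sum_sub_distrib]
  simp_rw [← covWalkSum_sub]
  refine norm_mean_le' fun i => (norm_covWalkSum_le_mass V _ _).trans ?_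
  have hD : ∀ s ∈ walk (emb y) (stairWord i.2.1 (off i.1)),
      ‖((fun b => (2 : ℂ)⁻¹ • (pertVar V W b - star (pertVar V W b))) - pertVar V W) s.bond‖ ≤ ‖pertVar V W s.bond‖ ^ 2 / 2 := by
    intro s _
    rw [Pi.sub_apply, ← norm_neg, neg_sub]
    exact norm_pertVar_sub_skewPart_le V W s.bond
  refine (mass_le_of_sq _ hD (hσ i.2.1 i.1)).trans ?_
  exact mul_le_mul_of_nonneg_left (hmC i.2.1 i.1) (by linarith)

/-- ★★ **THE SAME IN THE TWO-BLOCK NEIGHBOURHOOD OF A COARSE BOND** (standing range): at `y ∈ {c₋, c₊}`, with `S(c) = Σ_{blockOf b₋ ∈ {c₋,c₊}} ‖Y b‖`,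
`‖CM_Z(y) − CM_Y(y)‖ ≤ ((d+2)L·S(c))²/2` — the `δ` of ✓`PoincareLipschitzRegaugedStep.norm_pertVar_avgFun_regauged_le_nbhdMass`. [cite: Balaban1985Averaging, (62) p.28] -/
theorem norm_combMean_skewPart_sub_le_nbhdMass (hj : j + 1 ≤ P.m + P.K) (V W : GaugeField P j (Matrix.specialUnitaryGroup n ℂ)) (c : PBond P (j + 1))
    (y : Site P (j + 1)) (hy : y = c.src ∨ y = c.tgt) :
    ‖((Fintype.card (Idx P) : ℂ))⁻¹ • ∑ i : Idx P,
          covWalkSum V (fun b => (2 : ℂ)⁻¹ • (pertVar V W b - star (pertVar V W b))) (walk (emb y) (stairWord i.2.1 (off i.1)))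
        - ((Fintype.card (Idx P) : ℂ))⁻¹ • ∑ i : Idx P, covWalkSum V (pertVar V W) (walk (emb y) (stairWord i.2.1 (off i.1)))‖ ≤
      ((((P.d + 2) * P.L : ℕ) : ℝ) * ∑ b ∈ univ.filter (fun b : PBond P j => blockOf b.src = c.src ∨ blockOf b.src = c.tgt), ‖pertVar V W b‖) ^ 2 / 2 := by
  set S := ∑ b ∈ univ.filter (fun b : PBond P j => blockOf b.src = c.src ∨ blockOf b.src = c.tgt), ‖pertVar V W b‖ with hS
  have hS0 : 0 ≤ S := Finset.sum_nonneg fun b _ => norm_nonneg _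
  have hℓ1 : (1 : ℝ) ≤ (((P.d + 2) * P.L : ℕ) : ℝ) := by
    have := P.hL; exact_mod_cast (show 1 ≤ (P.d + 2) * P.L by nlinarith)
  -- every comb bond at `y` issues from the two blocks, so its norm is one term of `S`
  have hσ : ∀ (τ : Equiv.Perm (Fin P.d)) (r : Fin P.d → Fin P.L), ∀ s ∈ walk (emb y) (stairWord τ (off r)), ‖pertVar V W s.bond‖ ≤ S := by
    intro τ r s hs
    have hb : s.bond ∈ univ.filter (fun b : PBond P j => blockOf b.src = c.src ∨ blockOf b.src = c.tgt) := by
      refine Finset.mem_filter.2 ⟨Finset.mem_univ _, ?_⟩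
      have := Prop7TrueLinDefectBound.blockOf_src_of_mem_walk_stairWord hj y τ r s hs
      rcases hy with rfl | rfl
      · exact Or.inl this
      · exact Or.inr this
    exact Finset.single_le_sum (f := fun b => ‖pertVar V W b‖) (fun _ _ => norm_nonneg _) hb
  have hmC : ∀ (τ : Equiv.Perm (Fin P.d)) (r : Fin P.d → Fin P.L),
      ((walk (emb y) (stairWord τ (off r))).map fun s => ‖pertVar V W s.bond‖).sum ≤ (((P.d + 2) * P.L : ℕ) : ℝ) * S := by
    intro τ r
    rcases hy with rfl | rfl
    · exact mass_comb_src_le hj _ c τ r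
    · exact mass_comb_tgt_le hj _ c τ r
  refine (norm_combMean_skewPart_sub_le V W y hmC hσ hS0).trans ?_
  have : S ≤ (((P.d + 2) * P.L : ℕ) : ℝ) * S := le_mul_of_one_le_left hS0 hℓ1
  nlinarith [mul_nonneg (by positivity : (0:ℝ) ≤ (((P.d + 2) * P.L : ℕ) : ℝ)) hS0]

/-- ★ **THE COMB MEAN OF THE SKEW PROJECTION IS `𝔰𝔲(2)`-VALUED** (so `exp(−CM_Z)` is a gauge transformation: ✓`exists_gaugeTransf_coe_eq_exp_neg`).
[cite: Balaban1985BackgroundPropagators, (3.13)-(3.14) p.393] -/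
theorem su_combMean_skewPart (V W : GaugeField P j (Matrix.specialUnitaryGroup (Fin 2) ℂ)) (y : Site P (j + 1)) :
    star (((Fintype.card (Idx P) : ℂ))⁻¹ • ∑ i : Idx P,
          covWalkSum V (fun b => (2 : ℂ)⁻¹ • (pertVar V W b - star (pertVar V W b))) (walk (emb y) (stairWord i.2.1 (off i.1))))
        = -(((Fintype.card (Idx P) : ℂ))⁻¹ • ∑ i : Idx P,
          covWalkSum V (fun b => (2 : ℂ)⁻¹ • (pertVar V W b - star (pertVar V W b))) (walk (emb y) (stairWord i.2.1 (off i.1)))) ∧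
      (((Fintype.card (Idx P) : ℂ))⁻¹ • ∑ i : Idx P,
          covWalkSum V (fun b => (2 : ℂ)⁻¹ • (pertVar V W b - star (pertVar V W b))) (walk (emb y) (stairWord i.2.1 (off i.1)))).trace = 0 :=
  su_covCombMean V (fun b => su_skewPart_pertVar V W b) y

end Comb

end Summit.QuantumFields.YangMills.Theorems.PoincareLipschitzSkewProjection

end
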